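import Mathlib.LinearAlgebra.Matrix.GeneralLinearGroup.Card
import Literature.RepresentationTheory.FiniteGroups.GLBlockParabolic
import Literature.RepresentationTheory.FiniteGroups.FixedVectorsInducedConstituent
import Literature.RepresentationTheory.FiniteGroups.ProductGroupCharacters
import Literature.RepresentationTheory.FiniteGroups.GLnCharacterDegreeBoundProofs
import HarnessLib

/-!
# Cuspidal characters of `GL_n(𝔽_q)` and the Harish-Chandra reduction of the degree bound

Topic `Literature/RepresentationTheory/FiniteGroups`.  Companion to `GLnCharacterDegreeBound` (the
named fact `GreenGLnDegreeBound : χ(1) ≤ 2^n p^{n(n-1)/2}` for `χ ∈ Irr(GL_n(𝔽_p))`).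

* `GLn.IsCuspidal F n χ` — `χ` is a **cuspidal** irreducible character of `GL_n(F)`: for every
  decomposition `n = k + m` into positive parts, the sum of `χ` over the unipotent radical
  `U_{k,m} = {(1 B; 0 1)}` of the standard maximal parabolic `P_{k,m} = {(A B; 0 D)}` (blocks of sizes
  `k`, `m`; `GLBlock.parabolic`, kernel of `GLBlock.levi`, embedded in `GL_n(F)` along
  `Fin k ⊕ Fin m ≃ Fin n`) vanishes — i.e. the representation has no non-zero `U_{k,m}`-fixed vector
  for any proper standard parabolic (Harish-Chandra; Carter, *Finite Groups of Lie Type*, §9.1;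
  Digne–Michel, *Representations of Finite Groups of Lie Type*, Ch. 6; Bump, *Automorphic Forms and
  Representations*, §4.1; maximal parabolics suffice since `U_P ⊇ U_{P'}` for `P ⊆ P'`).

* `GLn.degree_mul_pow_le_of_cuspidal` — **the Harish-Chandra reduction**: if every cuspidal
  character `σ` of every `GL_m(F)`, `1 ≤ m`, satisfies `σ(1) q^m ≤ 2^m ψ_m(q)` (`q = |F|`,
  `ψ_m(q) = ∏_{i=1}^m (q^i - 1)`), then EVERY irreducible character `χ` of `GL_n(F)` satisfies
  `χ(1) q^n ≤ 2^n ψ_n(q)`.  Proof (strong induction on `n`): a non-cuspidal `χ` has a non-zero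
  `U_{k,m}`-fixed vector for some `k + m = n`, hence (`exists_irrChar_quotient_of_sum_ker_ne_zero`,
  file `FixedVectorsInducedConstituent`) `χ(1) ≤ [G : P_{k,m}] σ'(1)` for an irreducible character
  `σ'` of the Levi quotient `GL_k × GL_m`, which is `ψ ⊠ φ` (`exists_eq_boxProd_of_mem_irrChars`, file
  `ProductGroupCharacters`); by induction `ψ(1) q^k ≤ 2^k ψ_k`, `φ(1) q^m ≤ 2^m ψ_m`, and
  `[G : P_{k,m}] ψ_k(q) ψ_m(q) = ψ_n(q)` (`index_parabolic_mul`, from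
  `|P_{k,m}| = q^{km} |GL_k| |GL_m|` and `|GL_j(𝔽_q)| = q^{j(j-1)/2} ψ_j(q)`, Mathlib `Matrix.card_GL_field`).
  The cuspidal hypothesis holds with room to spare: the cuspidal degree is `ψ_{m-1}(q) = ψ_m(q)/(q^m-1)`
  (S. I. Gelfand 1970; Zelevinsky, LNM 869, §9–11; Green 1955), but that is Gelfand–Graev /
  Kirillov theory and is NOT proved here.

* `GLn.re_apply_one_le_of_cuspidal` and `GreenGLnDegreeBound_of_cuspidal` — with `ψ_n(q) ≤ q^{n(n-1)/2} q^n`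
  (`GreenGLn.psi_le`) this gives `χ(1) ≤ 2^n q^{n(n-1)/2}` in the real-exponent form of the fact, and
  `GreenGLnDegreeBound` from the cuspidal degree bound over the prime fields `ZMod p`.

Everything here is proved; the only definition is `GLn.IsCuspidal` (and a decidability instance
for membership in `GLBlock.parabolic`).

## References

* R. W. Carter, *Finite Groups of Lie Type: Conjugacy Classes and Complex Characters*, Wiley 1985,
  §9.1 (cuspidal characters, Harish-Chandra induction).
* I. G. Macdonald, *Symmetric Functions and Hall Polynomials*, 2nd ed. (1995), Ch. IV §6 [Macdonald1995].
* J. A. Green, *The characters of the finite general linear groups*, TAMS 80 (1955) [Green1955].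
-/

noncomputable section

open scoped BigOperators
open Matrix

namespace Literature.RepresentationTheory.FiniteGroups

/-! ### Transport of irreducible characters along group isomorphisms -/

/-- Irreducible characters pull back to irreducible characters along a group isomorphism
`e : K ≃* K'` (the invariant subspaces of `ρ ∘ e` are those of `ρ`). [folklore] -/
theorem IsIrrChar.comp_mulEquiv_of_equiv {K K' : Type} [Group K] [Group K'] {χ : K' → ℂ}
    (hχ : IsIrrChar K' χ) (e : K ≃* K') : IsIrrChar K (χ ∘ e) := by
  obtain ⟨W, _, _, _, σ, hσ, rfl⟩ := hχ
  refine ⟨W, _, _, inferInstance, σ.comp e.toMonoidHom, ?_, rfl⟩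
  haveI := hσ
  let f : Subrepresentation (σ.comp e.toMonoidHom) ≃o Subrepresentation σ :=
    { toFun := fun p => ⟨p.toSubmodule, fun g v hv => by
        have := p.apply_mem_toSubmodule (e.symm g) hv
        simpa using this⟩
      invFun := fun p => ⟨p.toSubmodule, fun g v hv => p.apply_mem_toSubmodule (e g) hv⟩
      left_inv := fun p => by ext; rfl
      right_inv := fun p => by ext; rfl
      map_rel_iff' := Iff.rfl }
  exact f.isSimpleOrder

namespace GLBlock

/-- Membership in the parabolic (vanishing of the lower-left block) is decidable. [folklore] -/
instance decidableMemParabolic {F : Type*} [CommRing F] [DecidableEq F] {m₁ m₂ : Type*} [Fintype m₁]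
    [Fintype m₂] [DecidableEq m₁] [DecidableEq m₂] : DecidablePred (· ∈ parabolic F m₁ m₂) :=
  fun g => inferInstanceAs (Decidable (((g : GL (m₁ ⊕ m₂) F) : Matrix (m₁ ⊕ m₂) (m₁ ⊕ m₂) F).toBlocks₂₁ = 0))

end GLBlock

namespace GLn

/-! ### The order of `GL_n(𝔽_q)` in the form `q^{n(n-1)/2} ψ_n(q)` -/

/-- `∏_{i<n} (q^n - q^i) = q^{n(n-1)/2} ∏_{i<n} (q^{i+1} - 1)`: pull `q^i` out of the `i`-th factor
and reflect. [folklore] -/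
theorem prod_pow_sub_pow_eq (q n : ℕ) :
    ∏ i ∈ Finset.range n, (q ^ n - q ^ i) = q ^ (n * (n - 1) / 2) * ∏ i ∈ Finset.range n, (q ^ (i + 1) - 1) := by
  have h1 : ∀ i ∈ Finset.range n, q ^ n - q ^ i = q ^ i * (q ^ (n - 1 - i + 1) - 1) := by
    intro i hi
    have hi' : i < n := Finset.mem_range.mp hi
    rw [Nat.mul_sub_one, ← pow_add]
    congr 2
    omega
  rw [Finset.prod_congr rfl h1, Finset.prod_mul_distrib, Finset.prod_pow_eq_pow_sum, Finset.sum_range_id,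
    Finset.prod_range_reflect (fun i => q ^ (i + 1) - 1) n]

/-- **`|GL_n(𝔽_q)| = q^{n(n-1)/2} ψ_n(q)`**, `ψ_n(q) = ∏_{i=1}^n (q^i - 1)` (Macdonald IV §6; from Mathlib's
`Matrix.card_GL_field : |GL_n(𝔽_q)| = ∏_{i<n} (q^n - q^i)`). [cite: Macdonald1995, Ch. IV §6] -/
theorem card_GL_fin (F : Type*) [Field F] [Fintype F] (n : ℕ) :
    Nat.card (GL (Fin n) F) =
      Fintype.card F ^ (n * (n - 1) / 2) * ∏ i ∈ Finset.range n, (Fintype.card F ^ (i + 1) - 1) := by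
  rw [Matrix.card_GL_field, Fin.prod_univ_eq_prod_range (fun i => Fintype.card F ^ n - Fintype.card F ^ i) n,
    prod_pow_sub_pow_eq]

/-- The exponent identity behind `|P_{k,m}| [G : P_{k,m}] = |GL_{k+m}|`:
`k m + k(k-1)/2 + m(m-1)/2 = (k+m)(k+m-1)/2`. [folklore] -/
theorem exponent_identity (k m : ℕ) :
    k * m + k * (k - 1) / 2 + m * (m - 1) / 2 = (k + m) * (k + m - 1) / 2 := by
  obtain ⟨a, ha⟩ := Nat.even_mul_pred_self k
  obtain ⟨b, hb⟩ := Nat.even_mul_pred_self m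
  obtain ⟨c, hc⟩ := Nat.even_mul_pred_self (k + m)
  have hpoly : (k + m) * (k + m - 1) = k * (k - 1) + m * (m - 1) + 2 * (k * m) := by
    rcases k with _ | k
    · simp
    · have e1 : k + 1 + m - 1 = k + m := by omega
      have e2 : k + 1 - 1 = k := by omega
      rw [e1, e2]
      rcases m with _ | m
      · simp
      · have e3 : m + 1 - 1 = m := by omega
        rw [e3]
        ring
  rw [ha, hb, hc] at hpoly
  rw [ha, hb, hc]
  omega

/-- **`[GL_{k+m} : P_{k,m}] · ψ_k(q) ψ_m(q) = ψ_{k+m}(q)`** (the `q`-binomial identity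
`[G : P] = ψ_n / (ψ_k ψ_m)`): from `|P_{k,m}| = q^{km} |GL_k| |GL_m|` (`GLBlock.card_parabolic`),
`|GL_j| = q^{j(j-1)/2} ψ_j` and `|G| = |P| [G : P]`. [folklore] -/
theorem index_parabolic_mul (F : Type*) [Field F] [Fintype F] (k m : ℕ) :
    (GLBlock.parabolic F (Fin k) (Fin m)).index *
        ((∏ i ∈ Finset.range k, (Fintype.card F ^ (i + 1) - 1)) *
          ∏ i ∈ Finset.range m, (Fintype.card F ^ (i + 1) - 1)) =
      ∏ i ∈ Finset.range (k + m), (Fintype.card F ^ (i + 1) - 1) := by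
  classical
  set q := Fintype.card F with hq
  have hq0 : 0 < q := Fintype.card_pos
  have hG : Nat.card (GL (Fin k ⊕ Fin m) F) = Nat.card (GL (Fin (k + m)) F) :=
    Nat.card_congr (GLBlock.reindex F finSumFinEquiv).toEquiv
  have key := Subgroup.card_mul_index (GLBlock.parabolic F (Fin k) (Fin m))
  rw [hG, GLBlock.card_parabolic, card_GL_fin, card_GL_fin, card_GL_fin, Nat.card_eq_fintype_card,
    Nat.card_eq_fintype_card, Fintype.card_fin, Nat.card_eq_fintype_card, Fintype.card_fin] at key
  -- collect the powers of `q`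
  have hexp := exponent_identity k m
  have hlhs : q ^ (k * m) * (q ^ (k * (k - 1) / 2) * (∏ i ∈ Finset.range k, (q ^ (i + 1) - 1)) *
      (q ^ (m * (m - 1) / 2) * ∏ i ∈ Finset.range m, (q ^ (i + 1) - 1))) *
        (GLBlock.parabolic F (Fin k) (Fin m)).index =
      q ^ ((k + m) * (k + m - 1) / 2) * ((GLBlock.parabolic F (Fin k) (Fin m)).index *
        ((∏ i ∈ Finset.range k, (q ^ (i + 1) - 1)) * ∏ i ∈ Finset.range m, (q ^ (i + 1) - 1))) := by
    rw [← hexp, pow_add, pow_add]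
    ring
  rw [hlhs] at key
  exact Nat.eq_of_mul_eq_mul_left (pow_pos hq0 _) key

/-! ### Cuspidal characters -/

variable (F : Type) [Field F] [Fintype F] [DecidableEq F]

/-- The embedding `GL(Fin k ⊕ Fin m, F) ≃* GL_{k+m}(F) = GL_n(F)` along `Fin k ⊕ Fin m ≃ Fin n`
(`finSumFinEquiv` and the cast `k + m = n`). [folklore] -/
def blockEquiv {n k m : ℕ} (h : k + m = n) : GL (Fin k ⊕ Fin m) F ≃* GL (Fin n) F :=
  GLBlock.reindex F (finSumFinEquiv.trans (finCongr h))

/-- An irreducible complex character `χ` of `GL_n(F)` is **cuspidal** if for every decomposition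
`n = k + m` with `k, m ≥ 1` the sum of `χ` over the unipotent radical
`U_{k,m} = {(1 B; 0 1)} = ker (P_{k,m} → GL_k × GL_m)` of the standard maximal parabolic
`P_{k,m} = {(A B; 0 D)}` vanishes, `∑_{u ∈ U_{k,m}} χ(u) = 0` — equivalently (`|U| dim V^U = ∑_U χ`)
the representation affording `χ` has no non-zero vector fixed by the unipotent radical of any
proper standard parabolic subgroup, i.e. `χ` is not a constituent of any parabolically induced
`Ind_{P}^{G} (infl σ)` from a proper Levi subgroup (Harish-Chandra; Carter, *Finite Groups of Lie
Type*, §9.1; Bump, *Automorphic Forms and Representations*, §4.1).  The blocks are placed in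
`GL_n(F)` along `Fin k ⊕ Fin m ≃ Fin n` (`blockEquiv`). [folklore] -/
def IsCuspidal (n : ℕ) (χ : GL (Fin n) F → ℂ) : Prop :=
  χ ∈ irrChars (GL (Fin n) F) ∧
    ∀ (k m : ℕ) (h : k + m = n), 1 ≤ k → 1 ≤ m →
      ∑ u : (GLBlock.levi F (Fin k) (Fin m)).ker,
        χ (blockEquiv F h ((u : GLBlock.parabolic F (Fin k) (Fin m)) : GL (Fin k ⊕ Fin m) F)) = 0

variable {F}

/-- A cuspidal character is an irreducible character. [folklore] -/
theorem IsCuspidal.mem_irrChars {n : ℕ} {χ : GL (Fin n) F → ℂ} (h : IsCuspidal F n χ) :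
    χ ∈ irrChars (GL (Fin n) F) :=
  h.1

omit [Fintype F] [DecidableEq F] in
/-- Irreducible characters of `GL_0(F)` (the trivial group) have degree `1`. [folklore] -/
theorem apply_one_eq_one_of_zero {χ : GL (Fin 0) F → ℂ} (hχ : χ ∈ irrChars (GL (Fin 0) F)) : χ 1 = 1 := by
  haveI := GreenGLn.isMulCommutative_generalLinearGroup_of_subsingleton (Fin 0) F
  exact IsIrrChar.map_one hχ

/-! ### The Harish-Chandra reduction -/

/-- **Harish-Chandra reduction of the degree bound to cuspidal characters.**  Let `F` be a finite
field with `q` elements and suppose every cuspidal character `σ` of `GL_m(F)`, `1 ≤ m`, satisfies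
`σ(1) · q^m ≤ 2^m ψ_m(q)`.  Then every irreducible character `χ` of `GL_n(F)` satisfies
`χ(1) · q^n ≤ 2^n ψ_n(q)` (`ψ_n(q) = ∏_{i=1}^n (q^i - 1)`), by strong induction on `n` through the
maximal parabolics (see the module docstring). [folklore] -/
theorem degree_mul_pow_le_of_cuspidal
    (hcusp : ∀ m : ℕ, 1 ≤ m → ∀ σ : GL (Fin m) F → ℂ, IsCuspidal F m σ →
      ∃ d : ℕ, σ 1 = d ∧ d * Fintype.card F ^ m ≤ 2 ^ m * ∏ i ∈ Finset.range m, (Fintype.card F ^ (i + 1) - 1))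
    (n : ℕ) (χ : GL (Fin n) F → ℂ) (hχ : χ ∈ irrChars (GL (Fin n) F)) :
    ∃ d : ℕ, χ 1 = d ∧ d * Fintype.card F ^ n ≤ 2 ^ n * ∏ i ∈ Finset.range n, (Fintype.card F ^ (i + 1) - 1) := by
  set q := Fintype.card F with hq
  induction n using Nat.strong_induction_on with
  | _ n ih =>
    rcases Nat.eq_zero_or_pos n with rfl | hn
    · exact ⟨1, by rw [apply_one_eq_one_of_zero hχ, Nat.cast_one], by simp⟩
    by_cases hc : IsCuspidal F n χ
    · exact hcusp n hn χ hc
    -- a non-cuspidal character has `U_{k,m}`-fixed vectors for some `k + m = n`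
    have hnc : ∃ (k m : ℕ) (h : k + m = n), 1 ≤ k ∧ 1 ≤ m ∧
        ∑ u : (GLBlock.levi F (Fin k) (Fin m)).ker,
          χ (blockEquiv F h ((u : GLBlock.parabolic F (Fin k) (Fin m)) : GL (Fin k ⊕ Fin m) F)) ≠ 0 := by
      by_contra hall
      exact hc ⟨hχ, fun k m h hk hm => Classical.byContradiction fun hne => hall ⟨k, m, h, hk, hm, hne⟩⟩
    obtain ⟨k, m, hkm, hk, hm, hsum⟩ := hnc
    -- transport `χ` to the block group
    set Φ := blockEquiv F hkm with hΦ
    set χ' : GL (Fin k ⊕ Fin m) F → ℂ := χ ∘ Φ with hχ'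
    have hχ'i : χ' ∈ irrChars (GL (Fin k ⊕ Fin m) F) := IsIrrChar.comp_mulEquiv_of_equiv hχ Φ
    have hsum' : ∑ u : (GLBlock.levi F (Fin k) (Fin m)).ker,
        χ' (((u : GLBlock.parabolic F (Fin k) (Fin m)) : GL (Fin k ⊕ Fin m) F)) ≠ 0 := hsum
    -- Harish-Chandra's lemma: `χ(1) ≤ [G : P] σ'(1)` with `σ'` an irreducible character of the Levi
    obtain ⟨σ', hσ', -, d, e, hd, he, hle⟩ :=
      exists_irrChar_quotient_of_sum_ker_ne_zero (GLBlock.parabolic F (Fin k) (Fin m))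
        (GLBlock.levi F (Fin k) (Fin m)) GLBlock.levi_surjective hχ'i hsum'
    -- `σ' = ψ ⊠ φ`
    obtain ⟨ψ, hψ, φ, hφ, rfl⟩ := exists_eq_boxProd_of_mem_irrChars hσ'
    -- induction hypotheses for the two blocks
    obtain ⟨dψ, hdψ, hψle⟩ := ih k (by omega) ψ hψ
    obtain ⟨dφ, hdφ, hφle⟩ := ih m (by omega) φ hφ
    have he' : e = dψ * dφ := by
      have h1 : ((e : ℕ) : ℂ) = (dψ * dφ : ℕ) := by
        rw [← he, Nat.cast_mul, ← hdψ, ← hdφ]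
        rfl
      exact Nat.cast_injective h1
    have hd' : χ 1 = d := by
      rw [← hd, hχ']
      simp
    refine ⟨d, hd', ?_⟩
    have hidx := index_parabolic_mul F k m
    rw [hkm] at hidx
    calc d * q ^ n = d * (q ^ k * q ^ m) := by rw [← pow_add, hkm]
      _ ≤ (GLBlock.parabolic F (Fin k) (Fin m)).index * (dψ * dφ) * (q ^ k * q ^ m) := by
          rw [← he']
          exact Nat.mul_le_mul_right _ hle
      _ = (GLBlock.parabolic F (Fin k) (Fin m)).index * ((dψ * q ^ k) * (dφ * q ^ m)) := by ring
      _ ≤ (GLBlock.parabolic F (Fin k) (Fin m)).index *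
            ((2 ^ k * ∏ i ∈ Finset.range k, (q ^ (i + 1) - 1)) *
              (2 ^ m * ∏ i ∈ Finset.range m, (q ^ (i + 1) - 1))) :=
          Nat.mul_le_mul_left _ (Nat.mul_le_mul hψle hφle)
      _ = 2 ^ (k + m) * ((GLBlock.parabolic F (Fin k) (Fin m)).index *
            ((∏ i ∈ Finset.range k, (q ^ (i + 1) - 1)) * ∏ i ∈ Finset.range m, (q ^ (i + 1) - 1))) := by
          rw [pow_add]; ring
      _ = 2 ^ n * ∏ i ∈ Finset.range n, (q ^ (i + 1) - 1) := by rw [hidx, hkm]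

/-- **The degree bound from the cuspidal bound, in the form of `GreenGLnDegreeBound`**: under the
cuspidal hypothesis, `χ(1) ≤ 2^n q^{n(n-1)/2}` for every irreducible character `χ` of `GL_n(F)`
(with `ψ_n(q) ≤ q^{n(n-1)/2} q^n`, `GreenGLn.psi_le`). [cite: Macdonald1995, Ch. IV §6 (6.7)-(6.8)] -/
theorem re_apply_one_le_of_cuspidal
    (hcusp : ∀ m : ℕ, 1 ≤ m → ∀ σ : GL (Fin m) F → ℂ, IsCuspidal F m σ →
      ∃ d : ℕ, σ 1 = d ∧ d * Fintype.card F ^ m ≤ 2 ^ m * ∏ i ∈ Finset.range m, (Fintype.card F ^ (i + 1) - 1))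
    (n : ℕ) (χ : GL (Fin n) F → ℂ) (hχ : χ ∈ irrChars (GL (Fin n) F)) :
    (χ 1).re ≤ 2 ^ n * (Fintype.card F : ℝ) ^ ((n : ℝ) * (n - 1) / 2) := by
  set q := Fintype.card F with hq
  obtain ⟨d, hd, hle⟩ := degree_mul_pow_le_of_cuspidal hcusp n χ hχ
  have hq0 : 0 < q := Fintype.card_pos
  have h1 : d * q ^ n ≤ 2 ^ n * q ^ (n * (n - 1) / 2) * q ^ n :=
    calc d * q ^ n ≤ 2 ^ n * ∏ i ∈ Finset.range n, (q ^ (i + 1) - 1) := hle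
      _ ≤ 2 ^ n * (q ^ (n * (n - 1) / 2) * q ^ n) := Nat.mul_le_mul_left _ (GreenGLn.psi_le n q)
      _ = 2 ^ n * q ^ (n * (n - 1) / 2) * q ^ n := by ring
  have h2 : d ≤ 2 ^ n * q ^ (n * (n - 1) / 2) := Nat.le_of_mul_le_mul_right h1 (pow_pos hq0 n)
  rw [hd, Complex.natCast_re, GreenGLn.rpow_half_mul_pred_eq]
  exact_mod_cast h2

end GLn

/-- **`GreenGLnDegreeBound` from the cuspidal degree bound.**  If for every prime `p` and every
`m ≥ 1` the cuspidal characters `σ` of `GL_m(𝔽_p)` satisfy `σ(1) p^m ≤ 2^m ψ_m(p)` (true, with room: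
`σ(1) = ψ_{m-1}(p)`, S. I. Gelfand 1970 / Green 1955 — not in the tree), then Green's degree bound
`χ(1) ≤ 2^n p^{n(n-1)/2}` holds for all irreducible characters of all `GL_n(𝔽_p)`.
[cite: Macdonald1995, Ch. IV §6 (6.7)-(6.8)] -/
theorem GreenGLnDegreeBound_of_cuspidal
    (hcusp : ∀ (p : ℕ) [Fact p.Prime] (m : ℕ), 1 ≤ m → ∀ σ : GL (Fin m) (ZMod p) → ℂ,
      GLn.IsCuspidal (ZMod p) m σ →
        ∃ d : ℕ, σ 1 = d ∧ d * p ^ m ≤ 2 ^ m * ∏ i ∈ Finset.range m, (p ^ (i + 1) - 1)) :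
    GreenGLnDegreeBound := by
  intro n p hp χ hχ
  have h := GLn.re_apply_one_le_of_cuspidal (F := ZMod p) (by simpa [ZMod.card] using hcusp p) n χ hχ
  simpa [ZMod.card] using h

end Literature.RepresentationTheory.FiniteGroups

end
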